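import Mathlib
import HarnessLib

/-!
# Route `LangevinControlUV`, crux `FemtoCurvatureTwoPointC` (stmt-QuantumFields-16204), line `birth` —
# triangular (top-link) iterated integration bound

Registered wave-3 sub-goal `lintegral_prod_le_pow_of_rank` (`--supports stmt-QuantumFields-16204`),
proved verbatim. This is the abstract "triangular integration" step behind the UPPER bound of the torus
partition-function sandwich (torus free energy ⇒ `L`-uniform doubling ⇒ the crux's variance-ceiling
stub V).

**Statement.** Let `μ` be a probability measure on `G`, `P` a finite family of "plaquettes" `p`, each
with a finite set of coordinates `links p ⊆ ι` on which the weight `w p : (ι → G) → [0, 1]` depends, and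
a distinguished coordinate `top p ∈ links p` whose rank `rk (top p)` dominates the ranks of `links p`
(for an injective rank `rk : ι → ℕ`), with `top` injective on `P`. If integrating out the top coordinate
alone gives `∫ w p (update U (top p) g) dμ(g) ≤ z` uniformly in `U`, then

  `∫ ∏_{p ∈ P} w p dμ^{⊗ ι} ≤ z ^ #P`.

**Proof.** Strong induction on `P`. For `P ≠ ∅` pick `q ∈ P` maximising `rk (top q)`
(`Finset.exists_max_image`). The coordinate `i := top q` belongs to NO `links p` with `p ∈ P \ {q}`:
otherwise `rk (top q) ≤ rk (top p) ≤ rk (top q)`, so `top p = top q` (`rk` injective) and `p = q`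
(`top` injective on `P`). Hence `F := ∏_{p ∈ P \ {q}} w p` does not depend on coordinate `i`, and the
one-coordinate marginal (`MeasureTheory.lmarginal_singleton`) of the full product satisfies
`∫ w q (update U i g) · F (update U i g) dμ(g) = (∫ w q (update U i g) dμ(g)) · F U ≤ z · F U`, which is
the one-coordinate marginal of the function `z · F` (as `μ` is a probability measure). By
`MeasureTheory.lintegral_le_of_lmarginal_le`, `∫ ∏_P w p ≤ ∫ z · F = z · ∫ F ≤ z · z ^ (#P - 1)` by the
induction hypothesis for `P \ {q}` (all hypotheses restrict to sub-families).

Everything is Mathlib (`MeasureTheory.lmarginal` API, `Finset` strong induction, `ℝ≥0∞` arithmetic);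
no named facts, no new definitions.
-/

set_option autoImplicit false

noncomputable section

open MeasureTheory
open scoped ENNReal

namespace Summit.QuantumFields.YangMills.Theorems.FemtoCurvatureTwoPointC.TorusGauge

/-- A function of `ι → G` that depends only on the coordinates in `s` is unchanged by updating a
coordinate `i ∉ s`. -/
private lemma dependsOn_apply_update_of_notMem {ι : Type} [DecidableEq ι] {G : Type} {β : Type}
    {f : (ι → G) → β} {s : Finset ι} (hf : DependsOn f ↑s) {i : ι} (hi : i ∉ s) (U : ι → G) (g : G) :
    f (Function.update U i g) = f U :=
  hf fun _ hj => Function.update_of_ne (ne_of_mem_of_not_mem hj hi) g U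

/-- **Triangular integration.** Let `μ` be a probability measure on `G`, `P` a finite family of "plaquettes" `p`, each
with a finite set of coordinates `links p` on which the weight `w p : (ι → G) → [0,1]` depends, and a distinguished
coordinate `top p ∈ links p` of maximal rank among `links p` (for an injective rank `rk : ι → ℕ`), `top` injective on `P`.
If integrating out the top coordinate alone already gives `∫ w p (update U (top p) g) dμ(g) ≤ z` uniformly in the other
coordinates, then `∫ ∏_{p ∈ P} w p d μ^{⊗ι} ≤ z ^ #P`. (Induction on `P`: integrate out the coordinate `top p*` of the
plaquette of maximal top rank first — no other plaquette of `P` depends on it.) -/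
theorem lintegral_prod_le_pow_of_rank :
    ∀ {ι : Type} [Fintype ι] [DecidableEq ι] {G : Type} [MeasurableSpace G] (μ : Measure G) [IsProbabilityMeasure μ]
      {κ : Type} (P : Finset κ) (links : κ → Finset ι) (top : κ → ι) (rk : ι → ℕ),
      Function.Injective rk → Set.InjOn top ↑P →
      (∀ p ∈ P, top p ∈ links p) → (∀ p ∈ P, ∀ i ∈ links p, rk i ≤ rk (top p)) →
      ∀ (w : κ → (ι → G) → ℝ≥0∞), (∀ p ∈ P, Measurable (w p)) → (∀ p ∈ P, ∀ U, w p U ≤ 1) →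
      (∀ p ∈ P, DependsOn (w p) ↑(links p)) →
      ∀ (z : ℝ≥0∞), (∀ p ∈ P, ∀ U : ι → G, ∫⁻ g, w p (Function.update U (top p) g) ∂μ ≤ z) →
      ∫⁻ U, ∏ p ∈ P, w p U ∂(Measure.pi fun _ : ι => μ) ≤ z ^ P.card := by
  intro ι _ _ G _ μ _ κ P
  classical
  induction P using Finset.strongInduction with
  | H P ih =>
    intro links top rk hrk htop hmem hle w hw hw1 hdep z hz
    rcases P.eq_empty_or_nonempty with rfl | hne
    · simp
    -- the plaquette `q` of maximal top rank, and its top coordinate `i`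
    obtain ⟨q, hq, hmax⟩ := P.exists_max_image (fun p => rk (top p)) hne
    set i : ι := top q
    -- no other plaquette of `P` touches the coordinate `i`
    have hnot : ∀ p ∈ P.erase q, i ∉ links p := by
      intro p hp hip
      have hpP : p ∈ P := Finset.mem_of_mem_erase hp
      have hpq : p ≠ q := Finset.ne_of_mem_erase hp
      have h1 : rk i ≤ rk (top p) := hle p hpP i hip
      have h2 : rk (top p) ≤ rk i := hmax p hpP
      have htp : top p = top q := hrk (le_antisymm h2 h1)
      exact hpq (htop hpP hq htp)
    -- the product over the remaining plaquettes
    set F : (ι → G) → ℝ≥0∞ := fun U => ∏ p ∈ P.erase q, w p U with hF_def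
    have hF_meas : Measurable F :=
      Finset.measurable_prod _ fun p hp => hw p (Finset.mem_of_mem_erase hp)
    have hFi : ∀ (U : ι → G) (g : G), F (Function.update U i g) = F U := by
      intro U g
      simp only [hF_def]
      refine Finset.prod_congr rfl fun p hp => ?_
      exact dependsOn_apply_update_of_notMem (hdep p (Finset.mem_of_mem_erase hp)) (hnot p hp) U g
    have hprod_meas : Measurable fun U : ι → G => ∏ p ∈ P, w p U :=
      Finset.measurable_prod _ fun p hp => hw p hp
    have hzF_meas : Measurable fun U : ι → G => z * F U := hF_meas.const_mul z
    -- Step 1: integrate out the coordinate `i` first (one-coordinate marginal comparison).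
    have step1 :
        ∫⁻ U, ∏ p ∈ P, w p U ∂(Measure.pi fun _ : ι => μ) ≤
          ∫⁻ U, z * F U ∂(Measure.pi fun _ : ι => μ) := by
      refine lintegral_le_of_lmarginal_le {i} hprod_meas hzF_meas ?_
      rw [lmarginal_singleton, lmarginal_singleton]
      intro U
      calc ∫⁻ g, ∏ p ∈ P, w p (Function.update U i g) ∂μ
          = ∫⁻ g, w q (Function.update U i g) * F U ∂μ := by
            refine lintegral_congr fun g => ?_
            rw [← Finset.mul_prod_erase P (fun p => w p (Function.update U i g)) hq]
            exact congrArg (w q (Function.update U i g) * ·) (hFi U g)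
        _ = (∫⁻ g, w q (Function.update U i g) ∂μ) * F U :=
            lintegral_mul_const _ ((hw q hq).comp (measurable_update U))
        _ ≤ z * F U := mul_le_mul' (hz q hq U) le_rfl
        _ = ∫⁻ _g, z * F U ∂μ := by rw [lintegral_const, measure_univ, mul_one]
        _ = ∫⁻ g, z * F (Function.update U i g) ∂μ := by simp_rw [hFi]
    -- Step 2: pull out the constant `z` and use the induction hypothesis on `P.erase q`.
    have ihF : ∫⁻ U, F U ∂(Measure.pi fun _ : ι => μ) ≤ z ^ (P.erase q).card := by
      refine ih (P.erase q) (Finset.erase_ssubset hq) links top rk hrk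
        (htop.mono (Finset.coe_subset.mpr (Finset.erase_subset q P)))
        (fun p hp => hmem p (Finset.mem_of_mem_erase hp))
        (fun p hp => hle p (Finset.mem_of_mem_erase hp)) w
        (fun p hp => hw p (Finset.mem_of_mem_erase hp))
        (fun p hp => hw1 p (Finset.mem_of_mem_erase hp))
        (fun p hp => hdep p (Finset.mem_of_mem_erase hp)) z
        (fun p hp => hz p (Finset.mem_of_mem_erase hp))
    calc ∫⁻ U, ∏ p ∈ P, w p U ∂(Measure.pi fun _ : ι => μ)
        ≤ ∫⁻ U, z * F U ∂(Measure.pi fun _ : ι => μ) := step1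
      _ = z * ∫⁻ U, F U ∂(Measure.pi fun _ : ι => μ) := lintegral_const_mul z hF_meas
      _ ≤ z * z ^ (P.erase q).card := mul_le_mul' le_rfl ihF
      _ = z ^ P.card := by rw [← pow_succ', Finset.card_erase_add_one hq]

end Summit.QuantumFields.YangMills.Theorems.FemtoCurvatureTwoPointC.TorusGauge

end
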